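import Summits.CriticalPhenomena.CardyFormulaZ2.Theses.CardySusyWard

/-!
# Route CardySusyWard — Assembly (item stmt-CriticalPhenomena-11294)

The assembly item of route `CardySusyWard` of the sub-problem `CardyFormulaZ2`:

  `WeakHolomorphy → ParafermionPrecompact → ParafermionFamiliesToSLESix → SLESixFamiliesGiveCardy
    → CardyFormulaZ2`.

This is pure logic (modus ponens): `ParafermionFamiliesToSLESix` is by definition
`WeakHolomorphy → ParafermionPrecompact → (SLE₆ for every Dobrushin domain and every admissible
discretisation family)`, and its conclusion is verbatim the antecedent of `SLESixFamiliesGiveCardy`,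
whose conclusion is `CardyFormulaZ2`.  The proof term is the one of the route's deciding theorem
`closes`: `hCardy (hToSLE hWeak hPrecompact)`.  All mathematical content sits in the four
hypotheses; nothing is assumed here.
-/

namespace Summit.CriticalPhenomena.CardyFormulaZ2.Theorems

open Summit.CriticalPhenomena.CardyFormulaZ2.Theses.CardySusyWard

/-- **Assembly of route CardySusyWard** (item stmt-CriticalPhenomena-11294): the chain
`WeakHolomorphy → ParafermionPrecompact → ParafermionFamiliesToSLESix → SLESixFamiliesGiveCardy →
CardyFormulaZ2` holds by modus ponens — feed the two analytic inputs to the SLE₆-identification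
implication and its conclusion to the SLE₆ ⇒ Cardy dictionary. -/
theorem cardySusyWard_assembly_proof :
    Summit.CriticalPhenomena.CardyFormulaZ2.Theses.CardySusyWard.Assembly := by
  unfold Summit.CriticalPhenomena.CardyFormulaZ2.Theses.CardySusyWard.Assembly
  intro hWeak hPrecompact hToSLE hCardy
  exact hCardy (hToSLE hWeak hPrecompact)

end Summit.CriticalPhenomena.CardyFormulaZ2.Theorems
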